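import Summits.ResolutionOfSingularities.ResolutionOfSingularities.Theorems.FrobeniusLadderFInjectiveMacaulayficationStalkChartIsoPoint
import Summits.ResolutionOfSingularities.ResolutionOfSingularities.Theorems.FrobeniusLadderFInjectiveMacaulayficationE8Char3ChartRingsRegular
import Summits.ResolutionOfSingularities.ResolutionOfSingularities.Theorems.FrobeniusLadderFInjectiveMacaulayficationE8Char3NotFiModel
import HarnessLib

/-!
# The stalks of `Bl_𝔪 E₈⁰` in characteristic `3` off the bad point satisfy the clause

Support file for crux stmt-ResolutionOfSingularities-15315 (`FrobeniusLadder.FInjectiveMacaulayfication`,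
line `Sketch`, lead seat c6, cycle 7, wave 2): stub `stub_e8Char3BlowupStalksOffBadPoint` (W2-A).

Let `k` be a field of characteristic `3`, `S = k[X₀, X₁, X₂]`, `f = X₂² + X₀³ + X₁⁵` (`E₈⁰`),
`R = S/(f)`, `𝔪 = (x̄₀, x̄₁, x̄₂)` and `X₁ = Bl_𝔪(Spec R) = affineBlowup 𝔪 = Proj R[𝔪t]`, covered by the
three charts `D₊(x̄ᵢt) = Spec Aᵢ`, `Aᵢ = (R[𝔪t])_{(x̄ᵢt)}`, through the open immersions `Proj.awayι`. The
`y`-chart is the hypersurface `S/(g_y)`, `g_y = X₂² + X₁X₀³ + X₁³`, along a presentation `d : S/(g_y) ≃+* A₁`;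
its origin `q₀ = d((X̄₀, X̄₁, X̄₂))` gives THE bad point `b = awayι₁ q₀` of `X₁` (an `E₇⁰`-type point, where the
clause fails in characteristic `3`, `E8Char3NotFiModel`). This file certifies that EVERY OTHER stalk of `X₁`
satisfies the crux's full stalk clause (domain; every system of parameters weakly regular; parameter ideals
Frobenius closed for the exponent base `3`), because it is a regular local ring of characteristic `3`:

* every point `y` is `awayιᵢ q` for a prime `q` of some chart ring `Aᵢ`, with `𝒪_y ≃+* (Aᵢ)_q`
  (`StalkChartIsoPoint.stub_stalkChartIsoPoint`);
* `i = 0`: `A₀ ≅ S/(gₓ)` (`StrictTransformChart.stub_strictTransformChart`, forms from `E8Forms.stub_e8Forms`),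
  all of whose local rings are regular (`E8Char3ChartRingsRegular.stub_e8Char3ChartRingsRegular`, part 1);
* `i = 1`: along the GIVEN `d`, the prime `d⁻¹(q)` is not the origin — otherwise `q = d(d⁻¹ q) = q₀` and
  `y = b` — so `(S/(g_y))_{d⁻¹ q}` is regular (part 2 of the same stub);
* `i = 2`: `x̄₂/1` is a unit of `A₂` (`E8ChartZUnit.stub_e8ChartZUnit`), so `q ∌ x̄₂/1` lies off the exceptional
  divisor, `(A₂)_q ≅ R_P`, `P = q ∩ R ∌ x̄₂` (`BlowupFiModel.nonempty_ringEquiv_offExceptional`), and `R_P` is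
  regular off the origin (`E8OffCentreRegularChar3.stub_e8OffCentreRegularChar3`);
* regular local rings of characteristic `3` satisfy the clause (`FiClauseOfRegular.stub_fiClauseOfRegular`:
  Matsumura Thm. 17.4 and Kunz), and the clause transports along ring isomorphisms (`fiClause_of_ringEquiv`).

References: H. Matsumura, *Commutative Ring Theory*, Cambridge Stud. Adv. Math. 8, CUP 1986, Thm. 17.4 and
Thm. 30.4 (ii) [Matsumura1987] (through the imported stubs); The Stacks Project, Tag 0804 (the affine blowup
algebras cover the blowing up). The assembly is folklore.
-/

-- single-problem summit: the doubled namespace component is forced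
set_option linter.dupNamespace false

noncomputable section

namespace Summit.ResolutionOfSingularities.ResolutionOfSingularities.Theorems.FInjectiveMacaulayfication.E8Char3BlowupStalksOffBadPoint

open AlgebraicGeometry CategoryTheory Literature.AlgebraicGeometry.Resolution
open Summit.ResolutionOfSingularities.ResolutionOfSingularities.Theorems.FInjectiveMacaulayfication

/-- A ring isomorphic to a regular local ring of characteristic `3` satisfies the crux's full stalk clause
(domain; every system of parameters weakly regular; parameter ideals Frobenius closed for the exponent base
`3`): regular local rings of prime characteristic satisfy it (`FiClauseOfRegular.stub_fiClauseOfRegular`),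
and the clause transports along ring isomorphisms (`fiClause_of_ringEquiv`). Stated over abstract rings so
that the chart-ring instance paths never meet the unifier. [folklore] -/
theorem fiClause_of_regular_ringEquiv {O B : Type} [CommRing O] [CommRing B] [IsRegularLocalRing O]
    [CharP O 3] (e : O ≃+* B) :
    IsDomain B ∧ ∀ d : ℕ, ringKrullDim B = d → ∀ s : Fin d → B,
      (Ideal.span (Set.range s)).radical.IsMaximal →
        RingTheory.Sequence.IsWeaklyRegular B (List.ofFn s) ∧
        ∀ y : B, (∃ n : ℕ, y ^ 3 ^ n ∈ Ideal.span ((fun z : B => z ^ 3 ^ n) ''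
          (Ideal.span (Set.range s) : Set B))) → y ∈ Ideal.span (Set.range s) := by
  haveI : Fact (Nat.Prime 3) := ⟨Nat.prime_three⟩
  exact fiClause_of_ringEquiv 3 e (FiClauseOfRegular.stub_fiClauseOfRegular 3 O)

/-- **Chart dictionary, regular case.** For a presentation `e : k[X]/(g) ≃+* A` of a chart ring, a prime `Q`
of `A` whose pulled-back local ring `(k[X]/(g))_{e⁻¹Q}` is regular, and a ring `S` with `S ≃+* A_Q` (a stalk
of the blowing up), the ring `S` satisfies the full stalk clause with exponent base `3`: `(k[X]/(g))_{e⁻¹Q}`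
has characteristic `3` (a non-trivial `k`-algebra, `CharP.of_ringHom_of_ne_zero`), is isomorphic to `A_Q`
(`E8Char5FiModel.nonempty_ringEquiv_localization_comap`), and `fiClause_of_regular_ringEquiv` applies to the
composite isomorphism. [folklore] -/
theorem fiClause_of_presentation (k : Type) [Field k] [CharP k 3] (g : MvPolynomial (Fin 3) k)
    {A S : Type} [CommRing A] [CommRing S] (e : (MvPolynomial (Fin 3) k ⧸ Ideal.span {g}) ≃+* A)
    (Q : Ideal A) [Q.IsPrime] (hreg : IsRegularLocalRing (Localization.AtPrime (Q.comap e.toRingHom)))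
    (est : S ≃+* Localization.AtPrime Q) :
    IsDomain S ∧ ∀ d : ℕ, ringKrullDim S = d → ∀ s : Fin d → S,
      (Ideal.span (Set.range s)).radical.IsMaximal →
        RingTheory.Sequence.IsWeaklyRegular S (List.ofFn s) ∧
        ∀ y : S, (∃ n : ℕ, y ^ 3 ^ n ∈ Ideal.span ((fun z : S => z ^ 3 ^ n) ''
          (Ideal.span (Set.range s) : Set S))) → y ∈ Ideal.span (Set.range s) := by
  haveI := hreg
  haveI : CharP (Localization.AtPrime (Q.comap e.toRingHom)) 3 :=
    CharP.of_ringHom_of_ne_zero (algebraMap k (Localization.AtPrime (Q.comap e.toRingHom))) 3 (by decide)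
  obtain ⟨eloc⟩ := E8Char5FiModel.nonempty_ringEquiv_localization_comap e Q
  exact fiClause_of_regular_ringEquiv (eloc.trans est.symm)

/-- **Off the exceptional divisor, regular case.** For the `E₈⁰` surface `R = k[X]/(f)` in characteristic `3`,
a prime `Q` of the chart ring `A₂ = (R[𝔪t])_{(x̄₂t)}` not containing `x̄₂/1`, and a ring `S ≃+* (A₂)_Q`, the
ring `S` satisfies the full stalk clause: `(A₂)_Q ≅ R_P`, `P = Q ∩ R ∌ x̄₂`
(`BlowupFiModel.nonempty_ringEquiv_offExceptional`), `P ⊉ 𝔪`, so `R_P` is a regular local ring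
(`E8OffCentreRegularChar3.stub_e8OffCentreRegularChar3`) of characteristic `3`. [folklore] -/
theorem fiClause_offExceptional (k : Type) [Field k] [CharP k 3] (f : MvPolynomial (Fin 3) k)
    (hf : f = MvPolynomial.X 2 ^ 2 + MvPolynomial.X 0 ^ 3 + MvPolynomial.X 1 ^ 5)
    (x : Fin 3 → MvPolynomial (Fin 3) k ⧸ Ideal.span {f})
    (hx : x = fun j : Fin 3 => Ideal.Quotient.mk (Ideal.span {f}) (MvPolynomial.X j))
    (Q : Ideal (HomogeneousLocalization.Away (reesGrading (Ideal.span (Set.range x)))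
      (reesT (x 2) (Ideal.subset_span (Set.mem_range_self 2))))) [Q.IsPrime]
    (huQ : reesChartBase (x 2) (Ideal.subset_span (Set.mem_range_self 2)) (x 2) ∉ Q)
    {S : Type} [CommRing S] (est : S ≃+* Localization.AtPrime Q) :
    IsDomain S ∧ ∀ d : ℕ, ringKrullDim S = d → ∀ s : Fin d → S,
      (Ideal.span (Set.range s)).radical.IsMaximal →
        RingTheory.Sequence.IsWeaklyRegular S (List.ofFn s) ∧
        ∀ y : S, (∃ n : ℕ, y ^ 3 ^ n ∈ Ideal.span ((fun z : S => z ^ 3 ^ n) ''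
          (Ideal.span (Set.range s) : Set S))) → y ∈ Ideal.span (Set.range s) := by
  obtain ⟨eoff⟩ := BlowupFiModel.nonempty_ringEquiv_offExceptional (x 2)
    (Ideal.subset_span (Set.mem_range_self 2)) Q huQ
  have hP : ¬ Ideal.span (Set.range fun j : Fin 3 => Ideal.Quotient.mk (Ideal.span {f}) (MvPolynomial.X j)) ≤
      Q.comap (reesChartBase (x 2) (Ideal.subset_span (Set.mem_range_self 2))) := by
    rw [← hx]
    intro hle
    exact huQ (Ideal.mem_comap.mp (hle (Ideal.subset_span (Set.mem_range_self 2))))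
  haveI : IsRegularLocalRing (Localization.AtPrime
      (Q.comap (reesChartBase (x 2) (Ideal.subset_span (Set.mem_range_self 2))))) :=
    E8OffCentreRegularChar3.stub_e8OffCentreRegularChar3 k f hf _ hP
  haveI : CharP (Localization.AtPrime
      (Q.comap (reesChartBase (x 2) (Ideal.subset_span (Set.mem_range_self 2))))) 3 :=
    CharP.of_ringHom_of_ne_zero (algebraMap k _) 3 (by decide)
  exact fiClause_of_regular_ringEquiv (eoff.symm.trans est.symm)

/-- **W2-A THE STALKS OF `Bl_𝔪 E₈⁰` (characteristic `3`) OFF THE BAD POINT** (registered stub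
`stub_e8Char3BlowupStalksOffBadPoint` of crux stmt-ResolutionOfSingularities-15315, line `Sketch`): for a field
`k` of characteristic `3`, `f = X₂² + X₀³ + X₁⁵`, `R = k[X]/(f)`, `𝔪 = (x̄₀, x̄₁, x̄₂)`, a presentation
`d : k[X]/(g_y) ≃+* A₁` of the `y`-chart ring and `q₀ = d(origin)`, every stalk of `affineBlowup 𝔪` at a point
`y ≠ awayι₁ q₀` is a domain all of whose systems of parameters are weakly regular with Frobenius-closed
parameter ideals. The point `y` is `awayιᵢ q` with `𝒪_y ≃+* (Aᵢ)_q` (`StalkChartIsoPoint.stub_stalkChartIsoPoint`);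
for `i = 0` the chart ring is `k[X]/(gₓ)`, regular everywhere; for `i = 1` the prime `d⁻¹ q` is not the origin
(else `q = q₀`, `y = awayι₁ q₀`), so `(k[X]/(g_y))_{d⁻¹q}` is regular
(`E8Char3ChartRingsRegular.stub_e8Char3ChartRingsRegular`); for `i = 2` the point lies off the exceptional
divisor (`E8ChartZUnit.stub_e8ChartZUnit`) over a regular point of `R` (`fiClause_offExceptional`); regular
local rings of characteristic `3` satisfy the clause (`fiClause_of_regular_ringEquiv`). [folklore] -/
theorem stub_e8Char3BlowupStalksOffBadPoint : ∀ (k : Type) [Field k] [CharP k 3] (f gy : MvPolynomial (Fin 3) k),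
    f = MvPolynomial.X 2 ^ 2 + MvPolynomial.X 0 ^ 3 + MvPolynomial.X 1 ^ 5 →
    gy = MvPolynomial.X 2 ^ 2 + MvPolynomial.X 1 * MvPolynomial.X 0 ^ 3 + MvPolynomial.X 1 ^ 3 →
    ∀ (x : Fin 3 → MvPolynomial (Fin 3) k ⧸ Ideal.span {f}),
      x = (fun j : Fin 3 => Ideal.Quotient.mk (Ideal.span {f}) (MvPolynomial.X j)) →
    ∀ (d : (MvPolynomial (Fin 3) k ⧸ Ideal.span {gy}) ≃+*
        HomogeneousLocalization.Away (reesGrading (Ideal.span (Set.range x)))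
          (reesT (x 1) (Ideal.subset_span (Set.mem_range_self 1))))
      (q₀ : PrimeSpectrum (HomogeneousLocalization.Away (reesGrading (Ideal.span (Set.range x)))
          (reesT (x 1) (Ideal.subset_span (Set.mem_range_self 1))))),
      q₀.asIdeal = Ideal.map d (Ideal.map (Ideal.Quotient.mk (Ideal.span {gy}))
        (Ideal.span (Set.range (MvPolynomial.X : Fin 3 → MvPolynomial (Fin 3) k)))) →
    ∀ y : ↥(affineBlowup (Ideal.span (Set.range x))),
      y ≠ (Proj.awayι (reesGrading (Ideal.span (Set.range x))) (reesT (x 1) (Ideal.subset_span (Set.mem_range_self 1)))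
          (reesT_mem (x 1) (Ideal.subset_span (Set.mem_range_self 1))) Nat.one_pos).base q₀ →
      IsDomain ((affineBlowup (Ideal.span (Set.range x))).presheaf.stalk y) ∧
      ∀ d' : ℕ, ringKrullDim ((affineBlowup (Ideal.span (Set.range x))).presheaf.stalk y) = d' →
        ∀ s : Fin d' → (affineBlowup (Ideal.span (Set.range x))).presheaf.stalk y,
          (Ideal.span (Set.range s)).radical.IsMaximal →
          RingTheory.Sequence.IsWeaklyRegular ((affineBlowup (Ideal.span (Set.range x))).presheaf.stalk y)
            (List.ofFn s) ∧
          ∀ z : (affineBlowup (Ideal.span (Set.range x))).presheaf.stalk y, (∃ e : ℕ, z ^ 3 ^ e ∈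
              Ideal.span ((fun w : (affineBlowup (Ideal.span (Set.range x))).presheaf.stalk y => w ^ 3 ^ e) ''
                (Ideal.span (Set.range s) : Set ((affineBlowup (Ideal.span (Set.range x))).presheaf.stalk y)))) →
            z ∈ Ideal.span (Set.range s) := by
  intro k _ _ f gy hf hgy x hx d q₀ hq₀ y hy
  -- the forms: `f` prime and non-zero, `gₓ` prime with `X₀ ∉ (gₓ)` and `θ₀ f = X₀² gₓ`
  have hforms := E8Forms.stub_e8Forms k f
    (MvPolynomial.X 2 ^ 2 + MvPolynomial.X 0 + MvPolynomial.X 0 ^ 3 * MvPolynomial.X 1 ^ 5) gy hf rfl hgy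
  obtain ⟨⟨hfp, hf0, -⟩, ⟨hgxp, hX0gx, hθx⟩, -⟩ := hforms
  -- the chart rings `k[X]/(gₓ)`, `k[X]/(g_y)` are regular (off the origin of the latter)
  have hreg := E8Char3ChartRingsRegular.stub_e8Char3ChartRingsRegular k
    (MvPolynomial.X 2 ^ 2 + MvPolynomial.X 0 + MvPolynomial.X 0 ^ 3 * MvPolynomial.X 1 ^ 5) gy rfl hgy
  -- the chart point under `y`: `y = awayιᵢ q`, `𝒪_y ≃ (Aᵢ)_q`
  have hpt := StalkChartIsoPoint.stub_stalkChartIsoPoint (MvPolynomial (Fin 3) k ⧸ Ideal.span {f}) 3 x y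
  obtain ⟨i, q, -, hqy, ⟨est⟩⟩ := hpt
  have hi : i = 0 ∨ i = 1 ∨ i = 2 := by
    fin_cases i <;> simp
  rcases hi with rfl | rfl | rfl
  · -- the `x`-chart `A₀ ≅ k[X]/(gₓ)`: every local ring is regular
    have h0 := StrictTransformChart.stub_strictTransformChart k f
      (MvPolynomial.X 2 ^ 2 + MvPolynomial.X 0 + MvPolynomial.X 0 ^ 3 * MvPolynomial.X 1 ^ 5) 0 2
      hfp hf0 hgxp hX0gx hθx x hx
    obtain ⟨e₀, -⟩ := h0
    have key := fiClause_of_presentation k _ e₀ q.asIdeal (hreg.1 _) est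
    exact key
  · -- the `y`-chart `A₁ ≅ k[X]/(g_y)` along the given `d`: `d⁻¹ q` is not the origin, since `y ≠ awayι₁ q₀`
    have hne : q.asIdeal.comap d.toRingHom ≠ Ideal.map (Ideal.Quotient.mk (Ideal.span {gy}))
        (Ideal.span (Set.range (MvPolynomial.X : Fin 3 → MvPolynomial (Fin 3) k))) := by
      intro heq
      apply hy
      have hqq : q = q₀ := by
        ext1
        rw [hq₀, ← heq, RingEquiv.toRingHom_eq_coe, Ideal.comap_coe,
          Ideal.map_comap_of_surjective d d.surjective]
      rw [← hqy, hqq]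
    have key := fiClause_of_presentation k gy d q.asIdeal (hreg.2 _ hne) est
    exact key
  · -- the `z`-chart misses the exceptional divisor: `x̄₂/1` is a unit, so `q ∌ x̄₂/1`
    have hunit := E8ChartZUnit.stub_e8ChartZUnit k f hf x hx
    have huq : reesChartBase (x 2) (Ideal.subset_span (Set.mem_range_self 2)) (x 2) ∉ q.asIdeal :=
      fun h => q.isPrime.ne_top (Ideal.eq_top_of_isUnit_mem _ h hunit)
    have key := fiClause_offExceptional k f hf x hx q.asIdeal huq est
    exact key

end Summit.ResolutionOfSingularities.ResolutionOfSingularities.Theorems.FInjectiveMacaulayfication.E8Char3BlowupStalksOffBadPoint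

end
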